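import Summits.ResolutionOfSingularities.ResolutionOfSingularities.Theorems.TeissierJungTeissierResolveOfToricNormalisation
import Summits.ResolutionOfSingularities.ResolutionOfSingularities.Theorems.TeissierJungTeissierResolveRegularBranchesGZero
import Summits.ResolutionOfSingularities.ResolutionOfSingularities.Theorems.TeissierJungTeissierResolveToricTargetPowerSeries
import Summits.ResolutionOfSingularities.ResolutionOfSingularities.Theorems.TeissierJungTeissierResolveToricNormalisationDimLeOne
import Literature.AlgebraicGeometry.Resolution.RegularLocalRingsNormal
import HarnessLib

/-!
# `TeissierResolve` ⇐ toric normalisation in dimension `≥ 2` with `g ≥ 1` equations + Bergh–Rydh + Artin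

Support theorem for the crux `stmt-ResolutionOfSingularities-17086`
(`Summit.ResolutionOfSingularities.ResolutionOfSingularities.Theses.TeissierJung.TeissierResolve`),
sharpening the reduction of `TeissierJungTeissierResolveOfToricNormalisation.lean`
(`teissierResolve_of_toricNormalisation`: the crux follows from Bergh–Rydh 2019 Thm 5, Artin 1969
Cor. 2.6 and TORIC NORMALISATION of Teissier-presented domains module-finite over `k⟦x₁..x_d⟧`).
Two slices of toric normalisation are now PROVED in the tree: `d ≤ 1`
(`ToricNormalisationDimLeOne.stub_toricNormalisation_dimLeOne`: the normalisation is `k` or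
`k⟦s⟧`) and `g = 0` (the presented ring is `k⟦x⟧` itself, regular hence normal, and `k⟦x⟧` is a
trivially graded completed toric ring, `ToricTargetPowerSeries.stub_toricTarget_powerSeries`). So
the hypothesis shrinks to its genuine research core:

* `toricNormalisation_of_general` — toric normalisation for ALL `(d, B)` from the case `d ≥ 2`,
  `g ≥ 1` (the presentation unpacked: datum `(n, v, c, A, μ, h)` with `Teissier.IsDatum`, `ψ` over
  `k⟦x⟧`), by the case split `d ≤ 1` / `g = 0` / general;
* `teissierResolve_of_toricNormalisation_general` — **`TeissierResolve` ⇐ Bergh–Rydh 2019 Thm 5 +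
  Artin 1969 Cor 2.6 + toric normalisation of Teissier branches in dimension `≥ 2` with `g ≥ 1`**.

This is the exact residue of line `Sketch` (`Cruxes/TeissierResolve/Lines/Sketch.lean`, stubs
`stub_berghRydh2019`, `stub_artin1969Cor26`, `stub_toricNormalisation_general`). No printed source
is known for the residue in characteristic `p`; in characteristic `0` the quasi-ordinary analogue is
González Pérez 2000 / Popescu-Pampu ("the normalisation of a quasi-ordinary singularity is the
toric singularity `ℂ{σ^∨ ∩ M}`", arXiv:2511.09126 Lemma 2.4). Everything here is [folklore]
plumbing; no definitions, no named facts.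
-/

noncomputable section

set_option linter.dupNamespace false -- mandated namespace of this single-conjunct summit

open CategoryTheory AlgebraicGeometry TopologicalSpace IsLocalRing
open Literature.AlgebraicGeometry.Resolution

namespace Summit.ResolutionOfSingularities.ResolutionOfSingularities.Theorems.TeissierResolve.OfToricNormalisationGeneral

attribute [local instance] MvPolynomial.weightedGradedAlgebra

/-- TORIC NORMALISATION of Teissier-presented domains from its case `d ≥ 2`, `g ≥ 1` (`hTgen`),
by cases: `d ≤ 1` (landed slice `stub_toricNormalisation_dimLeOne`); `g = 0` — then `B ≅ k⟦x⟧` is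
regular (`isRegularLocalRing_of_ringEquiv_teissierQuotient_zero`), hence integrally closed, so its
normalisation is `B ≅ k⟦x⟧` itself, a trivially graded completed toric ring (landed slice
`stub_toricTarget_powerSeries`); otherwise `hTgen`. [folklore] -/
theorem toricNormalisation_of_general
    (hTgen : ∀ {p : ℕ} [Fact p.Prime] (k : Type) [Field k]
      [CharP k p] [IsAlgClosed k] (d : ℕ) (hd : 2 ≤ d) (B : Type) [CommRing B] [IsDomain B]
      [Algebra (MvPowerSeries (Fin d) k) B] [Module.Finite (MvPowerSeries (Fin d) k) B]
      (g : ℕ) (hg : 0 < g) (n : Fin g → ℕ) (v : Fin g → (Fin d → ℚ)) (c : Fin g → k)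
      (A : Fin g → (Fin d →₀ ℕ)) (mu : Fin g → (Fin g →₀ ℕ))
      (h : Fin g → MvPolynomial (Fin g) (MvPowerSeries (Fin d) k))
      (hD : Teissier.IsDatum n v c A mu h)
      (ψ : B ≃+* (MvPolynomial (Fin g) (MvPowerSeries (Fin d) k) ⧸ Teissier.ideal n c A mu h))
      (hψ : ∀ a, ψ (algebraMap (MvPowerSeries (Fin d) k) B a) =
        Ideal.Quotient.mk _ (MvPolynomial.C a)),
      ∃ (d' : ℕ) (A' : Type) (_ : AddCommGroup A') (_ : Finite A') (_ : DecidableEq A')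
        (deg : Fin d' → A'),
        Nonempty (integralClosure B (FractionRing B) ≃+*
          AdicCompletion
            (RingHom.ker (MvPolynomial.constantCoeff.comp
              (algebraMap (MvPolynomial.weightedHomogeneousSubmodule k deg 0)
                (MvPolynomial (Fin d') k))))
            (MvPolynomial.weightedHomogeneousSubmodule k deg 0)))
    {p : ℕ} [Fact p.Prime] (k : Type) [Field k] [CharP k p]
    [IsAlgClosed k] (d : ℕ) (B : Type) [CommRing B] [IsDomain B]
    [Algebra (MvPowerSeries (Fin d) k) B] [Module.Finite (MvPowerSeries (Fin d) k) B]
    (hB : TeissierPresentation k d B (algebraMap (MvPowerSeries (Fin d) k) B)) :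
    ∃ (d' : ℕ) (A : Type) (_ : AddCommGroup A) (_ : Finite A) (_ : DecidableEq A)
      (deg : Fin d' → A),
      Nonempty (integralClosure B (FractionRing B) ≃+*
        AdicCompletion
          (RingHom.ker (MvPolynomial.constantCoeff.comp
            (algebraMap (MvPolynomial.weightedHomogeneousSubmodule k deg 0)
              (MvPolynomial (Fin d') k))))
          (MvPolynomial.weightedHomogeneousSubmodule k deg 0)) := by
  classical
  by_cases hd : d ≤ 1
  · exact ToricNormalisationDimLeOne.stub_toricNormalisation_dimLeOne (p := p) k d hd B
  obtain ⟨g, n, v, c, A, mu, h, hD, ψ, hψ⟩ := hB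
  rcases Nat.eq_zero_or_pos g with hg | hg
  · -- `g = 0`: `B ≅ k⟦x⟧` is regular, hence integrally closed: its normalisation is itself
    subst hg
    haveI : IsRegularLocalRing B :=
      RegularBranches.isRegularLocalRing_of_ringEquiv_teissierQuotient_zero n c A mu h ψ
    haveI : IsIntegrallyClosed B := isIntegrallyClosed_of_isRegularLocalRing B
    have hbot : integralClosure B (FractionRing B) = ⊥ :=
      (IsIntegrallyClosed.integralClosure_eq_bot_iff (FractionRing B)).mpr inferInstance
    -- `B ≅ k⟦x⟧`
    have hI : Teissier.ideal n c A mu h = ⊥ :=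
      RegularBranches.Teissier.ideal_eq_bot_of_isEmpty n c A mu h
    let e₁ : B ≃+* MvPowerSeries (Fin d) k :=
      ψ.trans (((Ideal.quotEquivOfEq hI).trans (RingEquiv.quotientBot _)).trans
        (MvPolynomial.isEmptyAlgEquiv (MvPowerSeries (Fin d) k) (Fin 0)).toRingEquiv)
    let e₀ : integralClosure B (FractionRing B) ≃+* B :=
      ((Subalgebra.equivOfEq _ _ hbot).trans
        (Algebra.botEquivOfInjective (IsFractionRing.injective B (FractionRing B)))).toRingEquiv
    obtain ⟨d', A', _, _, _, deg, ⟨e₂⟩⟩ := ToricTargetPowerSeries.stub_toricTarget_powerSeries k d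
    exact ⟨d', A', inferInstance, inferInstance, inferInstance, deg, ⟨(e₀.trans e₁).trans e₂⟩⟩
  · exact hTgen (p := p) k d (by omega) B g hg n v c A mu h hD ψ hψ

/-- **`TeissierResolve` ⇐ Bergh–Rydh 2019 Thm 5 + Artin 1969 Cor 2.6 + toric normalisation of
Teissier branches in dimension `≥ 2` with `g ≥ 1` equations** (the residue of line `Sketch`):
`teissierResolve_of_toricNormalisation` fed with `toricNormalisation_of_general`. [folklore] -/
theorem teissierResolve_of_toricNormalisation_general
    (hBR : BerghRydh2019_diagonalizableQuotientResolution) (hA : Artin1969Corollary26.{0})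
    (hTgen : ∀ {p : ℕ} [Fact p.Prime] (k : Type) [Field k]
      [CharP k p] [IsAlgClosed k] (d : ℕ) (hd : 2 ≤ d) (B : Type) [CommRing B] [IsDomain B]
      [Algebra (MvPowerSeries (Fin d) k) B] [Module.Finite (MvPowerSeries (Fin d) k) B]
      (g : ℕ) (hg : 0 < g) (n : Fin g → ℕ) (v : Fin g → (Fin d → ℚ)) (c : Fin g → k)
      (A : Fin g → (Fin d →₀ ℕ)) (mu : Fin g → (Fin g →₀ ℕ))
      (h : Fin g → MvPolynomial (Fin g) (MvPowerSeries (Fin d) k))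
      (hD : Teissier.IsDatum n v c A mu h)
      (ψ : B ≃+* (MvPolynomial (Fin g) (MvPowerSeries (Fin d) k) ⧸ Teissier.ideal n c A mu h))
      (hψ : ∀ a, ψ (algebraMap (MvPowerSeries (Fin d) k) B a) =
        Ideal.Quotient.mk _ (MvPolynomial.C a)),
      ∃ (d' : ℕ) (A' : Type) (_ : AddCommGroup A') (_ : Finite A') (_ : DecidableEq A')
        (deg : Fin d' → A'),
        Nonempty (integralClosure B (FractionRing B) ≃+*
          AdicCompletion
            (RingHom.ker (MvPolynomial.constantCoeff.comp
              (algebraMap (MvPolynomial.weightedHomogeneousSubmodule k deg 0)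
                (MvPolynomial (Fin d') k))))
            (MvPolynomial.weightedHomogeneousSubmodule k deg 0))) :
    Summit.ResolutionOfSingularities.ResolutionOfSingularities.Theses.TeissierJung.TeissierResolve :=
  OfToricNormalisation.teissierResolve_of_toricNormalisation hBR hA
    (fun k _ _ _ d B _ _ _ _ hB => toricNormalisation_of_general hTgen k d B hB)

end Summit.ResolutionOfSingularities.ResolutionOfSingularities.Theorems.TeissierResolve.OfToricNormalisationGeneral

end
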